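import Summits.ResolutionOfSingularities.ResolutionOfSingularities.Theorems.PurelyInseparableDim4WinCertLeafE5Fast15
import Summits.ResolutionOfSingularities.ResolutionOfSingularities.Theorems.PurelyInseparableDim4WinCertLeafTorusFast
import HarnessLib
import HarnessLib.Audit.Tags

/-!
# Purely inseparable fourfolds — F4-C kernel half OVER EVERY FIELD OF CHARACTERISTIC 2, batch E5 (root S1a-5637307d28, the ∀K 1,105th):
# THEOREM part «E5Fast16» = block checks 5…4 with the FAST torus block checker

Census cell «res-dim4-pi» (D-0157 DOOR 2); E5 chain of res-rescue-typ-3 g10 (Data1–8 ✓ p706480…p708289, Thm1 ✓ p709693 blocks 79–93, Thm2 ✓ p712093 blocks 75–78;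
kind files `…WinCertLeafTorusCore/Check/Torus`, `…WinCertLeafStill`), filer res-dim4-p-14 g4 (desk WORD #207 (a)).  The block STATEMENTS
`lcE5r1_ok<n> : twinCertBL 2 2 leafOK5 lcE5r1t<n> = true` are typ-3g10's, byte for byte; ONLY THE PROOF TERM differs from typ-3g10's theorem parts:
each block is checked by `twinCertTBL2` of `…WinCertLeafTorusFast` (typ-3's clauses verbatim except the reply test, which is res-dim4-p-13 g4's
Horner `InScopeWinCert.ireplyTOK`, p713047) and converted by `twinCertBL2_of_twinCertTBL2` before `twinCertBL_append_of` — because typ-3g10's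
one-`decide`-per-block proofs of blocks ≤ 72 exceed the per-`decide` ceiling of the gate node (p712378 bounced, p713942 `node-rc=134`;
block 72 alone: FAIL after 162 s with the original reply test, 28 s with the Horner test; measured by p-14 g4, cell bus 2026-08-29 l.6589).
CERTIFIED here: `lcE5r1_ok4` (blocks 4..93 check).  The HEADLINE `forall_inScopeStateWins_lcertsE5` is in `…WinCertLeafE5` (unchanged text of typ-3g10).
NOT CERTIFIED: anything about other roots; F4-C(2,2) (`TerminatesInScope 2 2` stays OPEN); the full game; resolution of anything.
[OURS · counted 0 · AI kernel work, weaker than expert review.]  Nothing here proves resolution of singularities in dimension ≥ 4 / characteristic `p`.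
bears_on: LADDER-RESOLUTION:D157-DOOR2 (res-dim4-pi · F4-C ∀K column · E5 chain, fast block proofs). Supports stmt-ResolutionOfSingularities-16155 (helper).
-/

set_option linter.dupNamespace false

noncomputable section

namespace Summit.ResolutionOfSingularities.ResolutionOfSingularities.Theorems.PIDim4

namespace WinCertLeaf

open StepKit WinCertSound InScopeWinCert ScopeBlind WinCertAllFields WinCertFlat WinCertSubst
set_option maxRecDepth 200000 in
/-- Blocks 5..93 of root S1a-5637307d28 check. [OURS · ‖ K] [folklore] -/
theorem lcE5r1_ok5 : twinCertBL 2 2 leafOK5 lcE5r1t5 = true :=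
  show twinCertBL 2 2 leafOK5 (lcE5r1b5 ++ lcE5r1t6) = true from
  twinCertBL_append_of 2 2 leafOK5 (twinCertBL2_of_twinCertTBL2 2 2 leafOK5 (by decide +kernel)) lcE5r1_ok6

set_option maxRecDepth 200000 in
/-- Blocks 4..93 of root S1a-5637307d28 check. [OURS · ‖ K] [folklore] -/
theorem lcE5r1_ok4 : twinCertBL 2 2 leafOK5 lcE5r1t4 = true :=
  show twinCertBL 2 2 leafOK5 (lcE5r1b4 ++ lcE5r1t5) = true from
  twinCertBL_append_of 2 2 leafOK5 (twinCertBL2_of_twinCertTBL2 2 2 leafOK5 (by decide +kernel)) lcE5r1_ok5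

end WinCertLeaf

end Summit.ResolutionOfSingularities.ResolutionOfSingularities.Theorems.PIDim4

end
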